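import Summits.QuantumFields.BalabanUV.T4Continuum.Support.VariationalCovariantDirichletForm

/-!
# T⁴ programme, spine node NE2 (U1a), lane P2 — LEAF REG⁺ (Laplacian form) OF THE VARIATIONAL ROUTE, file 2/2: the Euler–Lagrange
# structure of the constrained minimiser (the multiplier, without KKT) and the k-UNIFORM bound `‖Δ_R H_kμ‖² ≤ Λ·Sc(H_kμ)` by
# UB⁺-duality, for the charged scalar (U(1) background = King's model), every torus, every level
# (`t4/skeletons/NE2-t4-ne2-p2.md` v0.5 §2.C / §7 supplier leaf s6; cell `pub-balaban`, NE2 formalisation swarm, leaf prover 09 gen 3)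

HONEST FRAMING (T4-DAG p. 1).  Rung (B)+1 only — NOT infinite volume, NOT a mass gap, NOT Clay.  Node NE2 (η-rate of the linear
theory) is NOT IN PRINT and NOT proved here.  MODEL LEVEL: bond phases `R` (data, no size assumption) and UNIT-MODULUS site transports
`T` (data) on the level-`n` torus `Tor (fine n M)` over the unit torus `Tor M`; lattice units; scalar (0-form) sector; ONE level (no
tower, no rate).  What is proved is OURS and elementary (finite-dimensional linear algebra + lattice bookkeeping); nothing printed is a
hypothesis; no `def … : Prop` fact; no `sorry`; axioms standard.  HONEST DEPENDENCY (cell, verbatim): continuum YM on T⁴ ⇐ BetaPertH ∧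
nine spine estimates (0/9 proved); BetaPertH ⇐ (D1) ∧ (D4) ∧ CAP+tail; G-an2-4 gates asym, D1 and NE2/3/4.

THE STATEMENT (leaf REG⁺ in the shape `hREG` of `VariationalCovariantAssembly.pair_bracket` (p211487):
`∀ μ f, Qk f = μ → (∀ g, Qk g = μ → Sc f ≤ Sc g) → ρ f ≤ C_R·(Sc f + qZ μ)`, here with `ρ` = the squared norm of the COVARIANT
LAPLACIAN `negLap R f = D_R†D_R f` of file 1/2 and NO `qZ` term needed).  From file 1/2's first variation (`dform_eq_zero_of_isMin`):
 * §3 BLOCK STRUCTURE (Euler–Lagrange WITHOUT KKT): testing against the two-point functions `T(bpt z j₀)·δ_{bpt z j} −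
   T(bpt z j)·δ_{bpt z j₀} ∈ ker Q_T` shows `x ↦ negLap R f x · T x` is CONSTANT on every block — the multiplier
   `mult T R f : Tor M → ℂ` of leaf D — and `negLap R f (bpt z j) = mult z · conj (T (bpt z j))` (`negLap_bpt_of_isMin`);
 * §4 MULTIPLIER BOUND BY UB⁺-DUALITY: testing the Euler–Lagrange identity against a competitor for the datum `mult` of the shape
   of leaf UB⁺ (`hUB : ∀ ν, ∃ λ, Q_T λ = ν ∧ dirR R λ ≤ Λ·nsq ν` — the `hUBc` binder of `pair_bracket`, discharged for
   `Λ = Λ_d·n^{d−2}(…)` by the NE2 swarm's UB⁺ supplier file, NOT here) and Cauchy–Schwarz for `dform` gives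
   `n^{2d}·nsq (mult) ≤ Λ·dirR R f` (`nsq_mult_le_of_isMin`, the skeleton's «n^{−d}‖ν‖² ≤ Λ·n⁻²·Δ′_k(μ)») and the END

     `nsq (negLap R f) ≤ Λ/n^d · dirR R f`      (`nsq_negLap_le_of_isMin`),

   in physical units (`Sc = n^{2−d}·dirR`, `‖Δ‖²_{L²} = n^{4−d}·nsq negLap`, `Λ = Λ_phys·n^{d−2}`): **`‖Δ_{R̄} H_k μ‖²_{L²} ≤ Λ_phys·Δ′_k(μ)`**,
   UNIFORM in `n`, the torus and the background — leaf REG⁺ for `ρ_Lap`, `C_R = Λ_phys`, no NE3, no propagator localisation;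
   `hREG`-literal form with arbitrary positive rescalings `Sc = σ·dirR`, `ρ = τ·nsq negLap`, any `qZ ≥ 0`: `hREG_of_hUB`.
Second-difference functionals a ONE⁺ supplier may prefer (directional `Σ_ν‖Δ^R_ν f‖²`, full covariant Hessian) are bounded by
`2·nsq (negLap R f) + O(plaquette defect²)·(…)` (covariant Bochner step) — a separate file, NOT claimed here.
-/

noncomputable section

namespace Summit.QuantumFields.BalabanUV.T4Continuum.VariationalCovariantRegularity


open Finset
open scoped ComplexConjugate
open Literature.MathematicalPhysics.QuantumFieldTheory.Balaban1983to89
open Literature.MathematicalPhysics.QuantumFieldTheory.Balaban1983to89.B5Prop11Plancherel (Tor fine unitVec)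
open Literature.MathematicalPhysics.QuantumFieldTheory.Balaban1983to89.B5Prop11Lower (nsq nsq_nonneg)
open Literature.MathematicalPhysics.QuantumFieldTheory.Balaban1983to89.B5Block118 (bpt)
open Literature.MathematicalPhysics.QuantumFieldTheory.Balaban1983to89.B5Blocks16 (bpt_injective blockOf blockOf_bpt)
open Literature.MathematicalPhysics.QuantumFieldTheory.Balaban1983to89.B5AverageCurlStokes (sum_blocks_real)
open Summit.QuantumFields.BalabanUV.T4Continuum.VariationalCovariantFederbush (cD)
open Summit.QuantumFields.BalabanUV.T4Continuum.VariationalCovariantPoincare (QT dirR)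

open Summit.QuantumFields.BalabanUV.T4Continuum.VariationalCovariantDirichletForm
variable {d : ℕ}

/-! ## §3 Block structure of the Euler–Lagrange equation (the multiplier, without KKT) -/

section Block

variable (n : ℕ) [NeZero n] (M : Fin d → ℕ) [hM : ∀ μ, NeZero (M μ)]

/-- the block parametrisation is injective (coordinate form of `B5Blocks16.bpt_injective`). [folklore] -/
theorem bpt_eq_bpt_iff {z z' : Tor M} {j j' : Fin d → Fin n} : bpt n M z' j' = bpt n M z j ↔ z' = z ∧ j' = j := by
  constructor
  · intro h
    have h2 := @bpt_injective d n _ M _ (z', j') (z, j) h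
    exact ⟨congrArg Prod.fst h2, congrArg Prod.snd h2⟩
  · rintro ⟨rfl, rfl⟩; rfl

/-- a transported block sum against a point mass sitting at `bpt z j`. [folklore] -/
theorem sum_block_single (T : Tor (fine n M) → ℂ) (z z' : Tor M) (j : Fin d → Fin n) (a : ℂ) :
    ∑ j', T (bpt n M z' j') * (Pi.single (bpt n M z j) a : Tor (fine n M) → ℂ) (bpt n M z' j')
      = if z' = z then T (bpt n M z j) * a else 0 := by
  simp_rw [Pi.single_apply, bpt_eq_bpt_iff n M]
  by_cases hz : z' = z
  · subst hz
    rw [if_pos rfl, Finset.sum_eq_single j]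
    · simp
    · intro j' _ hj'; simp [hj']
    · intro h; exact absurd (Finset.mem_univ j) h
  · rw [if_neg hz]
    exact Finset.sum_eq_zero fun j' _ => by simp [hz]

/-- a torus sum of `conj (point mass) · L`. [folklore] -/
theorem sum_conj_single_mul (p : Tor (fine n M)) (a : ℂ) (L : Tor (fine n M) → ℂ) :
    ∑ x, conj ((Pi.single p a : Tor (fine n M) → ℂ) x) * L x = conj a * L p := by
  rw [Finset.sum_eq_single p]
  · simp
  · intro x _ hx; simp [hx]
  · intro h; exact absurd (Finset.mem_univ _) h

/-- the TWO-POINT TEST FUNCTION inside block `z`: `T(bpt z j₀)·δ_{bpt z j} − T(bpt z j)·δ_{bpt z j₀}` — it lies in `ker Q_T`.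
[folklore] -/
def swapTest (T : Tor (fine n M) → ℂ) (z : Tor M) (j j₀ : Fin d → Fin n) : Tor (fine n M) → ℂ :=
  (Pi.single (bpt n M z j) (T (bpt n M z j₀)) : Tor (fine n M) → ℂ) - Pi.single (bpt n M z j₀) (T (bpt n M z j))

/-- `Q_T (swapTest) = 0`. [folklore] -/
theorem QT_swapTest (T : Tor (fine n M) → ℂ) (z : Tor M) (j j₀ : Fin d → Fin n) :
    QT n M T (swapTest n M T z j j₀) = 0 := by
  funext z'
  simp only [QT, swapTest, Pi.sub_apply, mul_sub, Finset.sum_sub_distrib, sum_block_single, Pi.zero_apply]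
  by_cases hz : z' = z
  · simp [hz, mul_comm]
  · simp [hz]

/-- pairing a field with the two-point test function. [folklore] -/
theorem inner_swapTest (T : Tor (fine n M) → ℂ) (z : Tor M) (j j₀ : Fin d → Fin n) (L : Tor (fine n M) → ℂ) :
    ∑ x, conj (swapTest n M T z j j₀ x) * L x
      = conj (T (bpt n M z j₀)) * L (bpt n M z j) - conj (T (bpt n M z j)) * L (bpt n M z j₀) := by
  simp only [swapTest, Pi.sub_apply, map_sub, sub_mul, Finset.sum_sub_distrib, sum_conj_single_mul]

omit [NeZero n] hM in
/-- unit-modulus transports: `T·conj T = 1`. [folklore] -/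
theorem mul_conj_eq_one_of_norm {T : Tor (fine n M) → ℂ} (hT : ∀ x, ‖T x‖ = 1) (x : Tor (fine n M)) :
    T x * conj (T x) = 1 := by
  rw [Complex.mul_conj', hT]; norm_num

/-- **EULER–LAGRANGE, BLOCK FORM**: at a constrained minimiser, `x ↦ (D_R†D_R f)(x)·T(x)` is CONSTANT on every block. [folklore] -/
theorem negLap_mul_T_eq_of_isMin {T : Tor (fine n M) → ℂ} (hT : ∀ x, ‖T x‖ = 1) (R : Tor (fine n M) → Fin d → ℂ)
    {μ : Tor M → ℂ} {f : Tor (fine n M) → ℂ} (hf : QT n M T f = μ)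
    (hmin : ∀ g, QT n M T g = μ → dirR n M R f ≤ dirR n M R g) (z : Tor M) (j j₀ : Fin d → Fin n) :
    negLap (fine n M) R f (bpt n M z j) * T (bpt n M z j) = negLap (fine n M) R f (bpt n M z j₀) * T (bpt n M z j₀) := by
  have h0 := dform_eq_zero_of_isMin n M T R hf hmin (QT_swapTest n M T z j j₀)
  rw [← inner_negLap, inner_swapTest] at h0
  have hTj := mul_conj_eq_one_of_norm n M hT (bpt n M z j)
  have hT0 := mul_conj_eq_one_of_norm n M hT (bpt n M z j₀)
  linear_combination (T (bpt n M z j) * T (bpt n M z j₀)) * h0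
    + (-(negLap (fine n M) R f (bpt n M z j) * T (bpt n M z j))) * hT0
    + (negLap (fine n M) R f (bpt n M z j₀) * T (bpt n M z j₀)) * hTj

/-- the EULER–LAGRANGE MULTIPLIER `c(z) = (D_R†D_R f)(bpt z 0)·T(bpt z 0)` (the `ν` of leaf D: `−Δ_R H_kμ = Q_T†ν`; read on the block's
base corner). [folklore] -/
def mult (T : Tor (fine n M) → ℂ) (R : Tor (fine n M) → Fin d → ℂ) (f : Tor (fine n M) → ℂ) (z : Tor M) : ℂ :=
  negLap (fine n M) R f (bpt n M z 0) * T (bpt n M z 0)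

/-- **EULER–LAGRANGE**: at a constrained minimiser `(D_R†D_R f)(bpt z j) = c(z)·conj T(bpt z j)`, i.e. `D_R†D_R f = Q_T†(n^d c)` —
obtained from the first variation alone, no KKT / `hard_square`. [folklore] -/
theorem negLap_bpt_of_isMin {T : Tor (fine n M) → ℂ} (hT : ∀ x, ‖T x‖ = 1) (R : Tor (fine n M) → Fin d → ℂ)
    {μ : Tor M → ℂ} {f : Tor (fine n M) → ℂ} (hf : QT n M T f = μ)
    (hmin : ∀ g, QT n M T g = μ → dirR n M R f ≤ dirR n M R g) (z : Tor M) (j : Fin d → Fin n) :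
    negLap (fine n M) R f (bpt n M z j) = mult n M T R f z * conj (T (bpt n M z j)) := by
  have h := negLap_mul_T_eq_of_isMin n M hT R hf hmin z j 0
  have hTj := mul_conj_eq_one_of_norm n M hT (bpt n M z j)
  unfold mult
  linear_combination conj (T (bpt n M z j)) * h + (-(negLap (fine n M) R f (bpt n M z j))) * hTj

/-- hence `Σ_x |D_R†D_R f|² = n^d·Σ_z |c(z)|²`. [folklore] -/
theorem nsq_negLap_eq_of_isMin {T : Tor (fine n M) → ℂ} (hT : ∀ x, ‖T x‖ = 1) (R : Tor (fine n M) → Fin d → ℂ)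
    {μ : Tor M → ℂ} {f : Tor (fine n M) → ℂ} (hf : QT n M T f = μ)
    (hmin : ∀ g, QT n M T g = μ → dirR n M R f ≤ dirR n M R g) :
    nsq (negLap (fine n M) R f) = (n : ℝ) ^ d * nsq (mult n M T R f) := by
  have hcard : (Fintype.card (Fin d → Fin n) : ℝ) = (n : ℝ) ^ d := by
    rw [Fintype.card_fun, Fintype.card_fin, Fintype.card_fin]; push_cast; ring
  unfold nsq
  rw [sum_blocks_real n M (fun x => ‖negLap (fine n M) R f x‖ ^ 2), Finset.mul_sum]
  refine sum_congr rfl fun z _ => ?_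
  simp_rw [negLap_bpt_of_isMin n M hT R hf hmin z, norm_mul, Complex.norm_conj, hT, mul_one]
  rw [sum_const, card_univ, nsmul_eq_mul, hcard]

/-- the Euler–Lagrange identity tested against any field `λ` with `Q_T λ = c`: `Σ_x conj(D†D f)·λ = n^d·Σ_z|c(z)|²`. [folklore] -/
theorem sum_conj_negLap_mul_of_isMin {T : Tor (fine n M) → ℂ} (hT : ∀ x, ‖T x‖ = 1) (R : Tor (fine n M) → Fin d → ℂ)
    {μ : Tor M → ℂ} {f : Tor (fine n M) → ℂ} (hf : QT n M T f = μ)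
    (hmin : ∀ g, QT n M T g = μ → dirR n M R f ≤ dirR n M R g)
    {lam : Tor (fine n M) → ℂ} (hlam : QT n M T lam = mult n M T R f) :
    ∑ x, conj (negLap (fine n M) R f x) * lam x = (((n : ℝ) ^ d * nsq (mult n M T R f) : ℝ) : ℂ) := by
  have hn : ((n : ℂ) ^ d) ≠ 0 := pow_ne_zero _ (by exact_mod_cast NeZero.ne n)
  have hblock : ∀ z : Tor M, ∑ j, T (bpt n M z j) * lam (bpt n M z j) = (n : ℂ) ^ d * mult n M T R f z := by
    intro z
    have h := congrFun hlam z
    simp only [QT] at h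
    rw [← h, ← mul_assoc, mul_inv_cancel₀ hn, one_mul]
  rw [B5Blocks16.sum_blocks n M (fun x => conj (negLap (fine n M) R f x) * lam x)]
  simp_rw [negLap_bpt_of_isMin n M hT R hf hmin, map_mul, Complex.conj_conj]
  have e : ∀ z : Tor M, ∑ j, conj (mult n M T R f z) * T (bpt n M z j) * lam (bpt n M z j)
      = conj (mult n M T R f z) * ((n : ℂ) ^ d * mult n M T R f z) := by
    intro z; rw [← hblock z, Finset.mul_sum]; exact sum_congr rfl fun j _ => by ring
  simp_rw [e]
  unfold nsq
  push_cast
  rw [Finset.mul_sum]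
  exact sum_congr rfl fun z _ => by rw [← Complex.conj_mul']; ring

end Block

/-! ## §4 The multiplier bound by UB⁺-duality and the END (leaf REG⁺, Laplacian form) -/

section Reg

variable (n : ℕ) [NeZero n] (M : Fin d → ℕ) [hM : ∀ μ, NeZero (M μ)]

/-- Cauchy–Schwarz for the sesquilinear Dirichlet form: `|dform g f|² ≤ dirR g · dirR f`. [folklore] -/
theorem norm_dform_sq_le (R : Tor (fine n M) → Fin d → ℂ) (g f : Tor (fine n M) → ℂ) :
    ‖dform (fine n M) R g f‖ ^ 2 ≤ dirR n M R g * dirR n M R f := by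
  set F : Fin d × Tor (fine n M) → ℝ := fun p => ‖cD (fine n M) R g p.2 p.1‖ with hF
  set G : Fin d × Tor (fine n M) → ℝ := fun p => ‖cD (fine n M) R f p.2 p.1‖ with hG
  have h1 : ‖dform (fine n M) R g f‖ ≤ ∑ p : Fin d × Tor (fine n M), F p * G p := by
    rw [Fintype.sum_prod_type]
    unfold dform
    refine (norm_sum_le _ _).trans (sum_le_sum fun μ _ => (norm_sum_le _ _).trans (sum_le_sum fun x _ => ?_))
    rw [norm_mul, Complex.norm_conj]
  have h2 := Finset.sum_mul_sq_le_sq_mul_sq (Finset.univ) F G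
  have hg : ∑ p : Fin d × Tor (fine n M), F p ^ 2 = dirR n M R g := by
    rw [Fintype.sum_prod_type]; rfl
  have hf : ∑ p : Fin d × Tor (fine n M), G p ^ 2 = dirR n M R f := by
    rw [Fintype.sum_prod_type]; rfl
  rw [hg, hf] at h2
  exact (pow_le_pow_left₀ (norm_nonneg _) h1 2).trans h2

/-- **THE MULTIPLIER BOUND** (skeleton REG⁺: «n^{−d}‖ν‖² ≤ Λ·n⁻²·Δ′_k(μ)»): at a constrained minimiser, for any UB⁺-type constant `Λ`,
`n^{2d}·Σ_z|c(z)|² ≤ Λ·dirR R f`. [folklore] -/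
theorem nsq_mult_le_of_isMin {T : Tor (fine n M) → ℂ} (hT : ∀ x, ‖T x‖ = 1) (R : Tor (fine n M) → Fin d → ℂ) {Λ : ℝ}
    (hΛ : 0 ≤ Λ) (hUB : ∀ ν : Tor M → ℂ, ∃ lam : Tor (fine n M) → ℂ, QT n M T lam = ν ∧ dirR n M R lam ≤ Λ * nsq ν)
    {μ : Tor M → ℂ} {f : Tor (fine n M) → ℂ} (hf : QT n M T f = μ)
    (hmin : ∀ g, QT n M T g = μ → dirR n M R f ≤ dirR n M R g) :
    ((n : ℝ) ^ d) ^ 2 * nsq (mult n M T R f) ≤ Λ * dirR n M R f := by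
  set m : ℝ := nsq (mult n M T R f) with hm
  have hm0 : 0 ≤ m := nsq_nonneg _
  have hdir0 : 0 ≤ dirR n M R f := by unfold dirR; positivity
  obtain ⟨lam, hlam, hlamb⟩ := hUB (mult n M T R f)
  -- the pairing identity and Cauchy–Schwarz
  have key : (((n : ℝ) ^ d * m : ℝ) : ℂ) = conj (dform (fine n M) R lam f) := by
    rw [← inner_negLap, map_sum, ← sum_conj_negLap_mul_of_isMin n M hT R hf hmin hlam]
    refine sum_congr rfl fun x _ => ?_
    rw [map_mul, Complex.conj_conj, mul_comm]
  have hnorm : (n : ℝ) ^ d * m = ‖dform (fine n M) R lam f‖ := by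
    have := congrArg (fun w : ℂ => ‖w‖) key
    simp only [Complex.norm_conj] at this
    rw [← this, Complex.norm_real, Real.norm_of_nonneg (by positivity)]
  have hsq : ((n : ℝ) ^ d * m) ^ 2 ≤ Λ * m * dirR n M R f := by
    calc ((n : ℝ) ^ d * m) ^ 2 = ‖dform (fine n M) R lam f‖ ^ 2 := by rw [hnorm]
      _ ≤ dirR n M R lam * dirR n M R f := norm_dform_sq_le n M R lam f
      _ ≤ Λ * m * dirR n M R f := mul_le_mul_of_nonneg_right hlamb hdir0
  rcases eq_or_lt_of_le hm0 with h0 | hpos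
  · rw [← h0, mul_zero]; positivity
  · have : ((n : ℝ) ^ d) ^ 2 * m * m ≤ Λ * dirR n M R f * m := by nlinarith
    exact le_of_mul_le_mul_right this hpos

/-- **LEAF REG⁺ (Laplacian form), END**: at a constrained minimiser of the covariant Dirichlet sum on the fibre `{Q_T g = μ}`,

  `Σ_x |(D_R†D_R f)(x)|² ≤ (Λ/n^d)·dirR R f`

for every UB⁺-type constant `Λ` (`hUB`, the `hUBc` binder of `VariationalCovariantAssembly.pair_bracket`).  In physical units with
`Λ = Λ_phys·n^{d−2}`: `‖Δ_{R̄}H_kμ‖²_{L²} = n^{4−d}·nsq ≤ Λ_phys·n^{2−d}·dirR = Λ_phys·Δ′_k(μ)` — k-UNIFORM, no NE3, no propagator. [folklore] -/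
theorem nsq_negLap_le_of_isMin {T : Tor (fine n M) → ℂ} (hT : ∀ x, ‖T x‖ = 1) (R : Tor (fine n M) → Fin d → ℂ) {Λ : ℝ}
    (hΛ : 0 ≤ Λ) (hUB : ∀ ν : Tor M → ℂ, ∃ lam : Tor (fine n M) → ℂ, QT n M T lam = ν ∧ dirR n M R lam ≤ Λ * nsq ν)
    {μ : Tor M → ℂ} {f : Tor (fine n M) → ℂ} (hf : QT n M T f = μ)
    (hmin : ∀ g, QT n M T g = μ → dirR n M R f ≤ dirR n M R g) :
    nsq (negLap (fine n M) R f) ≤ Λ / (n : ℝ) ^ d * dirR n M R f := by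
  have hn : (0 : ℝ) < (n : ℝ) ^ d := by have := NeZero.ne n; positivity
  rw [nsq_negLap_eq_of_isMin n M hT R hf hmin]
  have h := nsq_mult_le_of_isMin n M hT R hΛ hUB hf hmin
  rw [div_mul_eq_mul_div, le_div_iff₀ hn]
  calc (n : ℝ) ^ d * nsq (mult n M T R f) * (n : ℝ) ^ d = ((n : ℝ) ^ d) ^ 2 * nsq (mult n M T R f) := by ring
    _ ≤ Λ * dirR n M R f := h

/-- **`hREG`-LITERAL FORM** (the binder of `VariationalCovariantAssembly.pair_bracket` for the charged scalar, with arbitrary positive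
rescalings `Sc = σ·dirR`, `ρ = τ·nsq negLap`, any nonnegative `qZ`): `Qk f = μ → (∀ g, Qk g = μ → Sc f ≤ Sc g) → ρ f ≤ C_R·(Sc f + qZ μ)`
with `C_R = τΛ/(n^d σ)` — for the physical scalings `σ = n^{2−d}`, `τ = n^{4−d}`, `Λ = Λ_phys n^{d−2}`: `C_R = Λ_phys`. [folklore] -/
theorem hREG_of_hUB {T : Tor (fine n M) → ℂ} (hT : ∀ x, ‖T x‖ = 1) (R : Tor (fine n M) → Fin d → ℂ) {Λ σ τ : ℝ}
    (hΛ : 0 ≤ Λ) (hσ : 0 < σ) (hτ : 0 ≤ τ)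
    (hUB : ∀ ν : Tor M → ℂ, ∃ lam : Tor (fine n M) → ℂ, QT n M T lam = ν ∧ dirR n M R lam ≤ Λ * nsq ν)
    {qZ : (Tor M → ℂ) → ℝ} (hqZ : ∀ μ, 0 ≤ qZ μ) (μ : Tor M → ℂ) (f : Tor (fine n M) → ℂ) (hf : QT n M T f = μ)
    (hmin : ∀ g, QT n M T g = μ → σ * dirR n M R f ≤ σ * dirR n M R g) :
    τ * nsq (negLap (fine n M) R f) ≤ (τ * Λ / ((n : ℝ) ^ d * σ)) * (σ * dirR n M R f + qZ μ) := by
  have hn : (0 : ℝ) < (n : ℝ) ^ d := by have := NeZero.ne n; positivity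
  have hmin' : ∀ g, QT n M T g = μ → dirR n M R f ≤ dirR n M R g := fun g hg => le_of_mul_le_mul_left (hmin g hg) hσ
  have h := nsq_negLap_le_of_isMin n M hT R hΛ hUB hf hmin'
  have hcoef : 0 ≤ τ * Λ / ((n : ℝ) ^ d * σ) := by positivity
  calc τ * nsq (negLap (fine n M) R f) ≤ τ * (Λ / (n : ℝ) ^ d * dirR n M R f) := mul_le_mul_of_nonneg_left h hτ
    _ = (τ * Λ / ((n : ℝ) ^ d * σ)) * (σ * dirR n M R f) := by field_simp
    _ ≤ (τ * Λ / ((n : ℝ) ^ d * σ)) * (σ * dirR n M R f + qZ μ) := by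
        refine mul_le_mul_of_nonneg_left ?_ hcoef; linarith [hqZ μ]

end Reg

end Summit.QuantumFields.BalabanUV.T4Continuum.VariationalCovariantRegularity

end
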